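import Summits.ValiantsHypothesis.ValiantsHypothesis.Theorems.NcRotParseTreePermanent
import Summits.ValiantsHypothesis.ValiantsHypothesis.Theorems.NcSkewPermanent
import HarnessLib

/-!
# Eventually-binders for the typed and skew permanent rungs (ERRATUM repair)

REPAIR of the vacuous-admitting binders `perNotNcUptVP` / `perNotNcRotVP` (ERRATUM, decomp-valiant
bus 2126): those are stated `∃ n, …` and admit the witness `n = 0` (`PERM₀ = 1`, and no typed
circuit computes a non-zero constant: typed constants are `0`, typed letters are letters, typed
gates are homogeneous of positive degree or `0`). Here: EVENTUALLY-forms. Content =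
`ncPerPoly_upt` / `ncPerPoly_rot` at `n = 4r` for every large `r` (the typed lift `liftSubst` at
`n > 4r` uses the constant `1` on the extra diagonal, which typed normal forms cannot carry, so the
typed forms run along `n = 4r`) and `ncPerPoly_skew` at every `n ≥ 4r` via `perm_lift` (the skew
form runs along every `n`); `A_nc` (stmt-23446) / `PerNotNcVP` / VP ≠ VNP untouched; NOT a new
lower bound. NON-VACUITY: for every `n ≥ 1` there are comb-typed UPT-NF (hence rot-NF) and
fan-in-two skew circuits computing `PERM_n` — the sum over the `n!` permutations `π` of the chains
`((x_{π0,0} · x_{π1,1}) · x_{π2,2}) ⋯ x_{π(n-1),n-1}` typed by the left comb (at most `n · n!`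
gates) — so every parameter `n ≥ n₀` (resp. `r ≥ r₀`) below carries content.
-/

namespace Summit.ValiantsHypothesis.ValiantsHypothesis.Theorems.NcTypedPermanentEventually

set_option linter.dupNamespace false

open Literature.Computability.AlgebraicComplexity
  Literature.Computability.AlgebraicComplexity.ArithCircuit
  Summit.ValiantsHypothesis.ValiantsHypothesis.Theorems.NcSOSPermanent
  Summit.ValiantsHypothesis.ValiantsHypothesis.Theorems.NcSkewPermanent
  Summit.ValiantsHypothesis.ValiantsHypothesis.Theorems.NcUniqueParseTree
  Summit.ValiantsHypothesis.ValiantsHypothesis.Theorems.NcUniqueParseTreePermanent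
  Summit.ValiantsHypothesis.ValiantsHypothesis.Theorems.NcRotParseTree
  Summit.ValiantsHypothesis.ValiantsHypothesis.Theorems.NcRotParseTreePermanent

/-- Polynomial versus exponential, UNIFORMLY: `n^k < 2^n` for all large `n`. [folklore] -/
theorem pow_lt_two_pow_eventually (k : ℕ) : ∃ N : ℕ, ∀ n, N ≤ n → n ^ k < 2 ^ n := by
  have h1 : ∀ᶠ n : ℕ in Filter.atTop, ((n : ℝ) ^ k / 2 ^ n : ℝ) < 1 :=
    (tendsto_pow_const_div_const_pow_of_one_lt k one_lt_two).eventually_lt_const one_pos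
  obtain ⟨N, hN⟩ := Filter.eventually_atTop.1 h1
  refine ⟨N, fun n hn => ?_⟩
  have h3 : ((n : ℝ) ^ k : ℝ) < 2 ^ n := (div_lt_one (pow_pos two_pos n)).1 (hN n hn)
  exact_mod_cast h3

/-- Growth bookkeeping, UNIFORMLY in `j`: `(12j+12)·((12j+12)^c + c) < 2^j` for all large `j`.
[folklore] -/
theorem growth_eventually (c : ℕ) :
    ∃ j₀ : ℕ, ∀ j, j₀ ≤ j → (12 * j + 12) * ((12 * j + 12) ^ c + c) < 2 ^ j := by
  obtain ⟨N, hN⟩ := pow_lt_two_pow_eventually (c + 2)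
  refine ⟨N + 2 * 24 ^ (c + 1) + 1, fun j hj => ?_⟩
  have hjN : N ≤ j := by omega
  have hj24 : 2 * 24 ^ (c + 1) ≤ j := by omega
  have hX : 12 * j + 12 ≤ 24 * j := by omega
  have h2c : c < 2 ^ c := Nat.lt_two_pow_self
  have hc : c ≤ (12 * j + 12) ^ c :=
    h2c.le.trans (Nat.pow_le_pow_left (show 2 ≤ 12 * j + 12 by omega) c)
  calc (12 * j + 12) * ((12 * j + 12) ^ c + c)
      ≤ (12 * j + 12) * ((12 * j + 12) ^ c + (12 * j + 12) ^ c) :=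
        Nat.mul_le_mul_left _ (Nat.add_le_add_left hc _)
    _ = 2 * (12 * j + 12) ^ (c + 1) := by ring
    _ ≤ 2 * (24 * j) ^ (c + 1) := Nat.mul_le_mul_left _ (Nat.pow_le_pow_left hX _)
    _ = 2 * 24 ^ (c + 1) * j ^ (c + 1) := by ring
    _ ≤ j * j ^ (c + 1) := Nat.mul_le_mul_right _ hj24
    _ = j ^ (c + 2) := by ring
    _ < 2 ^ j := hN j hjN

/-- **ROTATION-UPT rung, eventually-form** (REPAIR of the vacuous-admitting binder
`perNotNcRotVP` (ERRATUM bus 2126): eventually-form along `n = 4r`; content = `ncPerPoly_rot` at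
`n = 4r`; `A_nc` stmt-23446 / `PerNotNcVP` / VP ≠ VNP untouched; NOT a new lower bound): for every
`c` there is `r₀` such that for EVERY `r ≥ r₀` no rotation-UPT-normal-form circuit of size
`≤ (4r)^c + c` computes `PERM_{4r}` (and rot-NF circuits computing `PERM_{4r}` exist for every
`r ≥ 1`, e.g. the comb-typed `n!`-chain sums). [cite: LagardeLimayeSrinivasan2018, §4 Theorem 17] -/
theorem perNotNcRotVP_eventually (c : ℕ) : ∃ r₀ : ℕ, ∀ r, r₀ ≤ r →
    ∀ (P : ArithCircuit ℂ (Fin (4 * r) × Fin (4 * r))) (T : Shape) (ty : ℕ → List Bool),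
      (∀ k (hk : k < P.gates.length), GateRot T ty (ty k) P.gates[k]) →
      OpTyped T ty [] P.output → P.ncEval = ncPerPoly ℂ (4 * r) → (4 * r) ^ c + c < P.size := by
  obtain ⟨j₀, hj₀⟩ := growth_eventually c
  refine ⟨3 * j₀ + 1, fun r hr P T ty hg ho h => ?_⟩
  have hle := ncPerPoly_rot ℂ (r := r) (by omega) P hg ho h
  by_contra hcon
  have hS : P.size ≤ (4 * r) ^ c + c := Nat.not_lt.1 hcon
  have hlt := hj₀ ((r + 1) / 3) (by omega)
  have hX : 4 * r ≤ 12 * ((r + 1) / 3) + 12 := by omega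
  have h1 : 4 * r * P.size ≤
      (12 * ((r + 1) / 3) + 12) * ((12 * ((r + 1) / 3) + 12) ^ c + c) :=
    Nat.mul_le_mul hX (hS.trans (Nat.add_le_add_right (Nat.pow_le_pow_left hX c) c))
  exact absurd hlt (Nat.not_lt.2 (hle.trans h1))

/-- **UPT rung, eventually-form** (REPAIR of the vacuous-admitting binder `perNotNcUptVP`
(ERRATUM bus 2126): eventually-form along `n = 4r`; content = `ncPerPoly_upt` / `ncPerPoly_rot`
at `n = 4r` (UPT-NF ⊆ rot-NF by `GateRot.of_gateTyped`); `A_nc` stmt-23446 / `PerNotNcVP` /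
VP ≠ VNP untouched; NOT a new lower bound): for every `c` there is `r₀` such that for EVERY
`r ≥ r₀` no UPT-normal-form circuit of size `≤ (4r)^c + c` computes `PERM_{4r}`.
[cite: LagardeLimayeSrinivasan2018, §3 Theorem 10] -/
theorem perNotNcUptVP_eventually (c : ℕ) : ∃ r₀ : ℕ, ∀ r, r₀ ≤ r →
    ∀ (P : ArithCircuit ℂ (Fin (4 * r) × Fin (4 * r))) (T : Shape) (ty : ℕ → List Bool),
      (∀ k (hk : k < P.gates.length), GateTyped T ty (ty k) P.gates[k]) →
      OpTyped T ty [] P.output → P.ncEval = ncPerPoly ℂ (4 * r) → (4 * r) ^ c + c < P.size := by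
  obtain ⟨r₀, h₀⟩ := perNotNcRotVP_eventually c
  exact ⟨r₀, fun r hr P T ty hg ho h =>
    h₀ r hr P T ty (fun k hk => GateRot.of_gateTyped (hg k hk)) ho h⟩

/-- **SKEW rung, eventually-form** (companion of the repairs above; the `∃ n` binder
`perNotNcSkewVP` is not vacuous-admitting, this is its strictly stronger eventually-form; content
= `ncPerPoly_skew` at every `n ≥ 4r` via `perm_lift`; `A_nc` stmt-23446 / `PerNotNcVP` / VP ≠ VNP
untouched; NOT a new lower bound): for every `c` there is `n₀` such that for EVERY `n ≥ n₀` no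
fan-in-two skew circuit of size `≤ n^c + c` computes `PERM_n`.
[cite: LagardeLimayeSrinivasan2018, §1] -/
theorem perNotNcSkewVP_eventually (c : ℕ) : ∃ n₀ : ℕ, ∀ n, n₀ ≤ n →
    ∀ P : ArithCircuit ℂ (Fin n × Fin n), P.IsFanInTwo → P.IsSkew → P.ncEval = ncPerPoly ℂ n →
      n ^ c + c < P.size := by
  obtain ⟨j₀, hj₀⟩ := growth_eventually c
  refine ⟨4 * j₀ + 4, fun n hn P h2 hs h => ?_⟩
  have hle := ncPerPoly_skew ℂ (r := n / 4) (by omega) (Nat.mul_div_le n 4) P h2 hs h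
  by_contra hcon
  have hS : P.size ≤ n ^ c + c := Nat.not_lt.1 hcon
  have hlt := hj₀ (n / 4) (by omega)
  have hX : n ≤ 12 * (n / 4) + 12 := by omega
  have h1 : (n / 4 + 1) * P.size ≤ (12 * (n / 4) + 12) * ((12 * (n / 4) + 12) ^ c + c) :=
    Nat.mul_le_mul (by omega) (hS.trans (Nat.add_le_add_right (Nat.pow_le_pow_left hX c) c))
  exact absurd hlt (Nat.not_lt.2 (hle.trans h1))

end Summit.ValiantsHypothesis.ValiantsHypothesis.Theorems.NcTypedPermanentEventually
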